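import Mathlib
import Summits.Ventures.PercRepro2.TypedHarrisCluster
import Summits.Ventures.PercRepro2.TypedUntouched
import Summits.Ventures.PercRepro2.RootBridgeSupport

/-!
# The root-bridge class of row 2′TRI, III: the theorem (blind cell PercRepro2, p3 g0, 2026-08-25;
`proofs/P3-BRIDGE.md` §2, sub-claim S2.b)

THEOREM (`typedCount_nonneg_of_rootBridge`, `typedCount_nonneg_of_rootBridge'`,
`typedCount_nonneg_of_hasRootBridgeSameSide`): on a root-bridge instance with `o, b` on `a₁`'s
side and `v, a₃` on the far side, `0 ≤ typedCount F z τ K₃`, with the exact form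
(`typedCount_eq_rootBridge`)

  `typedCount F z τ K₃ = (S_same − S_cross) · T₁ · (inert count)`,

`S_same − S_cross` the typed Harris slack of `{o ∈ C(a₁)}`, `{b ∈ C(a₁)}` on the `l`-side
(`sSame_sub_sCross_nonneg`, from `TypedHarris.typedCount_cluster_harris`) and `T₁` the typed count,
over the `h`-side typed edges together with the bridge, of the coefficient `H1` — nonnegative
because its symmetrisation over the copy order is (`count_H1_nonneg`, from `sym_H1_nonneg` and
`six_mul_typedCount`); the three cross coefficients pay exactly `T₁` (`count_sum_eq_zero`, from
`sym_sum_eq_zero`).  The count factorises over the `l`-side, the `h⁺`-side and the inert edges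
(`typedCount_mul_three`), and the copy symmetry identifies the three cross `l`-monomials with
`S_cross`.  The `z ≡ false` form `typedCount_nonneg_of_hasRootBridgeSameSide` is the shape
sub-claim S1's residual class consumes (`HasRootBridgeSameSide`).  Own work; standard axioms.
-/

namespace Summit.Ventures.PercRepro2

open UnionCluster

namespace CovForm

namespace RootBridge

open OneTyped TypedA3 Untouched TypedFactor Separated OneEdge

/-! ## The count -/

section Count

open Classical

variable {V : Type*} {E : Type*} [Fintype E] [DecidableEq E] {R : Type*} [Field R]
  [LinearOrder R] [IsStrictOrderedRing R]
variable (ends : E → Sym2 V) (o a₁ a₂ a₃ b v : V) (f : E)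

omit [LinearOrder R] [IsStrictOrderedRing R] in
/-- `typedCount` only sees the background off `F`. -/
lemma typedCount_congr_bg (F : Finset E) {z z' : Config E} (τ : E → ℕ)
    (hz : ∀ e, e ∉ F → z e = z' e) (K : Config E → Config E → Config E → R) :
    typedCount F z τ K = typedCount F z' τ K := by
  unfold typedCount
  refine Finset.sum_congr rfl fun x _ => Finset.sum_congr rfl fun y _ =>
    Finset.sum_congr rfl fun w _ => ?_
  have hiff : (∀ e, e ∉ F → x e = z e ∧ y e = z e ∧ w e = z e) ↔
      (∀ e, e ∉ F → x e = z' e ∧ y e = z' e ∧ w e = z' e) := by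
    constructor
    · intro h e he; rw [← hz e he]; exact h e he
    · intro h e he; rw [hz e he]; exact h e he
  simp only [hiff]

omit [LinearOrder R] [IsStrictOrderedRing R] in
/-- Four-term linearity of the typed count. -/
lemma typedCount_add4 (F : Finset E) (z : Config E) (τ : E → ℕ)
    (K₁ K₂ K₃ K₄ : Config E → Config E → Config E → R) :
    typedCount F z τ (fun x y w => K₁ x y w + K₂ x y w + K₃ x y w + K₄ x y w) =
      typedCount F z τ K₁ + typedCount F z τ K₂ + typedCount F z τ K₃ + typedCount F z τ K₄ := by
  unfold typedCount
  simp only [← Finset.sum_add_distrib]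
  refine Finset.sum_congr rfl fun x _ => Finset.sum_congr rfl fun y _ =>
    Finset.sum_congr rfl fun w _ => ?_
  split_ifs <;> simp

omit [IsStrictOrderedRing R] in
/-- A typed count of a pointwise nonnegative kernel is nonnegative. -/
lemma typedCount_nonneg_of_nonneg [IsOrderedRing R] (F : Finset E) (z : Config E) (τ : E → ℕ)
    {K : Config E → Config E → Config E → R} (hK : ∀ x y w, 0 ≤ K x y w) :
    0 ≤ typedCount F z τ K := by
  unfold typedCount
  refine Finset.sum_nonneg fun x _ => Finset.sum_nonneg fun y _ => Finset.sum_nonneg fun w _ => ?_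
  split_ifs
  · exact hK x y w
  · exact le_refl _

/-- The same-copy `l`-count `S_same = #{o, b ∈ C(a₁)}` (third copy). -/
noncomputable def sSame (A : Finset E) (z : Config E) (τ : E → ℕ) : R :=
  typedCount A z τ (fun _ _ w => iL ends a₁ b w * iL ends a₁ o w)

/-- The cross-copy `l`-count `S_cross = #{b ∈ C(a₁) in the second copy, o ∈ C(a₁) in the third}`. -/
noncomputable def sCross (A : Finset E) (z : Config E) (τ : E → ℕ) : R :=
  typedCount A z τ (fun _ y w => iL ends a₁ b y * iL ends a₁ o w)

/-- The typed Harris slack `S_same − S_cross ≥ 0` (`TypedHarris.typedCount_cluster_harris` and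
the copy symmetry). -/
theorem sSame_sub_sCross_nonneg (A : Finset E) (z : Config E) (τ : E → ℕ)
    (hτ : ∀ e ∈ A, τ e = 1 ∨ τ e = 2) :
    0 ≤ sSame (R := R) ends o a₁ b A z τ - sCross (R := R) ends o a₁ b A z τ := by
  have hH := TypedHarris.typedCount_cluster_harris (R := R) ends a₁ o b A z τ hτ
  have e1 : sSame (R := R) ends o a₁ b A z τ =
      typedCount A z τ (fun x _ _ => (iL ends a₁ o x : R) * iL ends a₁ b x) := by
    unfold sSame
    rw [← typedCount_swap13 A z τ hτ (fun x _ _ => (iL ends a₁ o x : R) * iL ends a₁ b x)]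
    exact typedCount_congr' _ _ _ _ _ fun x y w => mul_comm _ _
  have e2 : sCross (R := R) ends o a₁ b A z τ =
      typedCount A z τ (fun x y _ => (iL ends a₁ o x : R) * iL ends a₁ b y) := by
    unfold sCross
    rw [← typedCount_swap13 A z τ hτ (fun x y _ => (iL ends a₁ o x : R) * iL ends a₁ b y)]
    exact typedCount_congr' _ _ _ _ _ fun x y w => mul_comm _ _
  rw [e1, e2]
  exact sub_nonneg.2 hH

omit [LinearOrder R] [IsStrictOrderedRing R] in
/-- The count of `lK1` is `S_same`. -/
lemma count_lK1 (A : Finset E) (z : Config E) (τ : E → ℕ) :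
    typedCount A z τ (lK1 ends o a₁ b : Config E → Config E → Config E → R) =
      sSame ends o a₁ b A z τ := rfl

omit [LinearOrder R] [IsStrictOrderedRing R] in
/-- The count of `lK2` is `S_cross` (copy symmetry `y ↔ w`). -/
lemma count_lK2 (A : Finset E) (z : Config E) (τ : E → ℕ) (hτ : ∀ e ∈ A, τ e = 1 ∨ τ e = 2) :
    typedCount A z τ (lK2 ends o a₁ b : Config E → Config E → Config E → R) =
      sCross ends o a₁ b A z τ := by
  unfold sCross
  rw [← typedCount_swap23 A z τ hτ (fun _ y w => (iL ends a₁ b y : R) * iL ends a₁ o w)]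
  rfl

omit [LinearOrder R] [IsStrictOrderedRing R] in
/-- The count of `lK3` is `S_cross` (commutativity). -/
lemma count_lK3 (A : Finset E) (z : Config E) (τ : E → ℕ) :
    typedCount A z τ (lK3 ends o a₁ b : Config E → Config E → Config E → R) =
      sCross ends o a₁ b A z τ :=
  typedCount_congr' _ _ _ _ _ fun x y w => by unfold lK3; ring

omit [LinearOrder R] [IsStrictOrderedRing R] in
/-- The count of `lK4` is `S_cross` (copy symmetry `x ↔ w`). -/
lemma count_lK4 (A : Finset E) (z : Config E) (τ : E → ℕ) (hτ : ∀ e ∈ A, τ e = 1 ∨ τ e = 2) :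
    typedCount A z τ (lK4 ends o a₁ b : Config E → Config E → Config E → R) =
      sCross ends o a₁ b A z τ := by
  unfold sCross
  rw [← typedCount_swap13 A z τ hτ (fun _ y w => (iL ends a₁ b y : R) * iL ends a₁ o w)]
  exact typedCount_congr' _ _ _ _ _ fun x y w => by unfold lK4; ring

/-- **The `h⁺`-count of `H1` is nonnegative**: six times it is the count of the symmetrised
kernel, which is pointwise nonnegative on the support (`sym_H1_nonneg`). -/
theorem count_H1_nonneg (B : Finset E) (hfB : f ∈ B) (z : Config E) (τ : E → ℕ)
    (hτ : ∀ e ∈ B, τ e = 1 ∨ τ e = 2) :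
    0 ≤ typedCount B z τ (hK ends a₂ a₃ v f H1 : Config E → Config E → Config E → R) := by
  have h6 := six_mul_typedCount B z τ hτ (hK ends a₂ a₃ v f H1 : Config E → Config E → Config E → R)
  have hK' : typedCount B z τ (fun x y w => (hK ends a₂ a₃ v f H1 x y w : R) +
      hK ends a₂ a₃ v f H1 x w y + hK ends a₂ a₃ v f H1 y x w + hK ends a₂ a₃ v f H1 y w x +
      hK ends a₂ a₃ v f H1 w x y + hK ends a₂ a₃ v f H1 w y x) =
      typedCount B z τ (fun x y w => if Adm (x f) (y f) (w f) then
        ((symH H1 (x f) (hst ends a₂ a₃ v f x) (y f) (hst ends a₂ a₃ v f y) (w f)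
          (hst ends a₂ a₃ v f w) : ℤ) : R) else 0) := by
    refine typedCount_congr_on_support B z τ fun x y w _ hc => ?_
    have hadm : Adm (x f) (y f) (w f) := by
      have := hc f hfB
      unfold openCount at this
      unfold Adm
      rcases hτ f hfB with h | h <;> omega
    rw [if_pos hadm]
    unfold hK symH
    push_cast
    ring
  have hpos : 0 ≤ typedCount B z τ (fun x y w => if Adm (x f) (y f) (w f) then
      ((symH H1 (x f) (hst ends a₂ a₃ v f x) (y f) (hst ends a₂ a₃ v f y) (w f)
        (hst ends a₂ a₃ v f w) : ℤ) : R) else 0) := by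
    refine typedCount_nonneg_of_nonneg _ _ _ fun x y w => ?_
    split_ifs with hadm
    · exact_mod_cast sym_H1_nonneg _ _ _ _ _ _ hadm
    · exact le_refl _
  have : (0 : R) ≤ 6 * typedCount B z τ (hK ends a₂ a₃ v f H1 : Config E → Config E → Config E → R) := by
    rw [h6, hK']; exact hpos
  linarith

/-- **The four `h⁺`-counts sum to zero** (`sym_sum_eq_zero`). -/
theorem count_sum_eq_zero (B : Finset E) (hfB : f ∈ B) (z : Config E) (τ : E → ℕ)
    (hτ : ∀ e ∈ B, τ e = 1 ∨ τ e = 2) :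
    typedCount B z τ (hK ends a₂ a₃ v f H1 : Config E → Config E → Config E → R) +
      typedCount B z τ (hK ends a₂ a₃ v f H2) + typedCount B z τ (hK ends a₂ a₃ v f H3) +
      typedCount B z τ (hK ends a₂ a₃ v f H4) = 0 := by
  rw [← typedCount_add4]
  have h6 := six_mul_typedCount B z τ hτ (fun x y w => (hK ends a₂ a₃ v f H1 x y w : R) +
    hK ends a₂ a₃ v f H2 x y w + hK ends a₂ a₃ v f H3 x y w + hK ends a₂ a₃ v f H4 x y w)
  have hzero : typedCount B z τ (fun x y w =>
      ((hK ends a₂ a₃ v f H1 x y w : R) + hK ends a₂ a₃ v f H2 x y w + hK ends a₂ a₃ v f H3 x y w +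
        hK ends a₂ a₃ v f H4 x y w) +
      ((hK ends a₂ a₃ v f H1 x w y : R) + hK ends a₂ a₃ v f H2 x w y + hK ends a₂ a₃ v f H3 x w y +
        hK ends a₂ a₃ v f H4 x w y) +
      ((hK ends a₂ a₃ v f H1 y x w : R) + hK ends a₂ a₃ v f H2 y x w + hK ends a₂ a₃ v f H3 y x w +
        hK ends a₂ a₃ v f H4 y x w) +
      ((hK ends a₂ a₃ v f H1 y w x : R) + hK ends a₂ a₃ v f H2 y w x + hK ends a₂ a₃ v f H3 y w x +
        hK ends a₂ a₃ v f H4 y w x) +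
      ((hK ends a₂ a₃ v f H1 w x y : R) + hK ends a₂ a₃ v f H2 w x y + hK ends a₂ a₃ v f H3 w x y +
        hK ends a₂ a₃ v f H4 w x y) +
      ((hK ends a₂ a₃ v f H1 w y x : R) + hK ends a₂ a₃ v f H2 w y x + hK ends a₂ a₃ v f H3 w y x +
        hK ends a₂ a₃ v f H4 w y x)) = typedCount B z τ (fun _ _ _ => (0 : R)) := by
    refine typedCount_congr_on_support B z τ fun x y w _ hc => ?_
    have hadm : Adm (x f) (y f) (w f) := by
      have := hc f hfB
      unfold openCount at this
      unfold Adm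
      rcases hτ f hfB with h | h <;> omega
    have h0 := sym_sum_eq_zero (x f) (hst ends a₂ a₃ v f x) (y f) (hst ends a₂ a₃ v f y) (w f)
      (hst ends a₂ a₃ v f w) hadm
    unfold symH at h0
    unfold hK
    have h0' : ((H1 (x f) (hst ends a₂ a₃ v f x) (y f) (hst ends a₂ a₃ v f y) (w f)
        (hst ends a₂ a₃ v f w) + H1 (x f) (hst ends a₂ a₃ v f x) (w f) (hst ends a₂ a₃ v f w) (y f)
        (hst ends a₂ a₃ v f y) + H1 (y f) (hst ends a₂ a₃ v f y) (x f) (hst ends a₂ a₃ v f x) (w f)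
        (hst ends a₂ a₃ v f w) + H1 (y f) (hst ends a₂ a₃ v f y) (w f) (hst ends a₂ a₃ v f w) (x f)
        (hst ends a₂ a₃ v f x) + H1 (w f) (hst ends a₂ a₃ v f w) (x f) (hst ends a₂ a₃ v f x) (y f)
        (hst ends a₂ a₃ v f y) + H1 (w f) (hst ends a₂ a₃ v f w) (y f) (hst ends a₂ a₃ v f y) (x f)
        (hst ends a₂ a₃ v f x) + (H2 (x f) (hst ends a₂ a₃ v f x) (y f) (hst ends a₂ a₃ v f y) (w f)
        (hst ends a₂ a₃ v f w) + H2 (x f) (hst ends a₂ a₃ v f x) (w f) (hst ends a₂ a₃ v f w) (y f)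
        (hst ends a₂ a₃ v f y) + H2 (y f) (hst ends a₂ a₃ v f y) (x f) (hst ends a₂ a₃ v f x) (w f)
        (hst ends a₂ a₃ v f w) + H2 (y f) (hst ends a₂ a₃ v f y) (w f) (hst ends a₂ a₃ v f w) (x f)
        (hst ends a₂ a₃ v f x) + H2 (w f) (hst ends a₂ a₃ v f w) (x f) (hst ends a₂ a₃ v f x) (y f)
        (hst ends a₂ a₃ v f y) + H2 (w f) (hst ends a₂ a₃ v f w) (y f) (hst ends a₂ a₃ v f y) (x f)
        (hst ends a₂ a₃ v f x)) + (H3 (x f) (hst ends a₂ a₃ v f x) (y f) (hst ends a₂ a₃ v f y) (w f)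
        (hst ends a₂ a₃ v f w) + H3 (x f) (hst ends a₂ a₃ v f x) (w f) (hst ends a₂ a₃ v f w) (y f)
        (hst ends a₂ a₃ v f y) + H3 (y f) (hst ends a₂ a₃ v f y) (x f) (hst ends a₂ a₃ v f x) (w f)
        (hst ends a₂ a₃ v f w) + H3 (y f) (hst ends a₂ a₃ v f y) (w f) (hst ends a₂ a₃ v f w) (x f)
        (hst ends a₂ a₃ v f x) + H3 (w f) (hst ends a₂ a₃ v f w) (x f) (hst ends a₂ a₃ v f x) (y f)
        (hst ends a₂ a₃ v f y) + H3 (w f) (hst ends a₂ a₃ v f w) (y f) (hst ends a₂ a₃ v f y) (x f)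
        (hst ends a₂ a₃ v f x)) + (H4 (x f) (hst ends a₂ a₃ v f x) (y f) (hst ends a₂ a₃ v f y) (w f)
        (hst ends a₂ a₃ v f w) + H4 (x f) (hst ends a₂ a₃ v f x) (w f) (hst ends a₂ a₃ v f w) (y f)
        (hst ends a₂ a₃ v f y) + H4 (y f) (hst ends a₂ a₃ v f y) (x f) (hst ends a₂ a₃ v f x) (w f)
        (hst ends a₂ a₃ v f w) + H4 (y f) (hst ends a₂ a₃ v f y) (w f) (hst ends a₂ a₃ v f w) (x f)
        (hst ends a₂ a₃ v f x) + H4 (w f) (hst ends a₂ a₃ v f w) (x f) (hst ends a₂ a₃ v f x) (y f)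
        (hst ends a₂ a₃ v f y) + H4 (w f) (hst ends a₂ a₃ v f w) (y f) (hst ends a₂ a₃ v f y) (x f)
        (hst ends a₂ a₃ v f x)) : ℤ) : R) = 0 := by
      rw [h0]; simp
    push_cast at h0' ⊢
    linear_combination h0'
  have : (6 : R) * (typedCount B z τ (hK ends a₂ a₃ v f H1) + typedCount B z τ (hK ends a₂ a₃ v f H2) +
      typedCount B z τ (hK ends a₂ a₃ v f H3) + typedCount B z τ (hK ends a₂ a₃ v f H4)) = 0 := by
    rw [← typedCount_add4, h6, hzero, typedCount_zero_kernel]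
  rw [← typedCount_add4] at this
  have h6ne : (6 : R) ≠ 0 := by norm_num
  exact (mul_eq_zero.1 this).resolve_left h6ne

/-- **The root-bridge identity**: for a root-bridge instance with `o, b` on `a₁`'s side and
`v, a₃` on the far side,
`typedCount F z τ K₃ = (S_same − S_cross) · T₁ · (inert count)` with `T₁` the `h⁺`-count of `H1`
(the `h`-side typed edges with the bridge) and the inert count over `F ∖ (sides ∪ {f})`. -/
theorem typedCount_eq_rootBridge (F : Finset E) (z : Config E) (τ : E → ℕ)
    (hτ : ∀ e ∈ F, τ e = 1 ∨ τ e = 2) (hzf : z f = false) (hf : f ∈ F)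
    (hends : ends f = s(a₁, v)) (hsep : Sep ends a₁ a₂ (F.erase f) z)
    (hv : v ∈ cluster ends (zF (F.erase f) z) a₂) (ho : o ∈ cluster ends (zF (F.erase f) z) a₁)
    (hb : b ∈ cluster ends (zF (F.erase f) z) a₁) (h3 : a₃ ∈ cluster ends (zF (F.erase f) z) a₂) :
    typedCount F z τ (K3 ends o a₁ a₂ a₃ b : Config E → Config E → Config E → R) =
      (sSame (R := R) ends o a₁ b (FL ends a₁ (F.erase f) z) z τ -
          sCross (R := R) ends o a₁ b (FL ends a₁ (F.erase f) z) z τ) *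
        typedCount (FL ends a₂ (F.erase f) z ∪ {f}) z τ
          (hK ends a₂ a₃ v f H1 : Config E → Config E → Config E → R) *
        typedCount (F \ (FL ends a₁ (F.erase f) z ∪ (FL ends a₂ (F.erase f) z ∪ {f}))) z τ
          (fun _ _ _ => (1 : R)) := by
  set A := FL ends a₁ (F.erase f) z with hA
  set B := FL ends a₂ (F.erase f) z ∪ {f} with hB
  set C := F \ (A ∪ B) with hC
  have hfL : f ∉ FL ends a₁ (F.erase f) z := fun h =>
    (Finset.mem_erase.1 (FL_subset ends a₁ (F.erase f) z h)).1 rfl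
  have hAF : A ⊆ F := fun e he =>
    Finset.mem_of_mem_erase (FL_subset ends a₁ (F.erase f) z he)
  have hBF : B ⊆ F := by
    intro e he
    rcases Finset.mem_union.1 he with he | he
    · exact Finset.mem_of_mem_erase (FL_subset ends a₂ (F.erase f) z he)
    · rw [Finset.mem_singleton.1 he]; exact hf
  have hAB : Disjoint A B := by
    rw [hB]
    refine Finset.disjoint_union_right.2 ⟨disjoint_FL ends a₁ a₂ (F.erase f) z hsep, ?_⟩
    exact Finset.disjoint_singleton_right.2 hfL
  have hABF : A ∪ B ⊆ F := Finset.union_subset hAF hBF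
  have hAC : Disjoint A C := Finset.disjoint_of_subset_left Finset.subset_union_left Finset.disjoint_sdiff
  have hBC : Disjoint B C := Finset.disjoint_of_subset_left Finset.subset_union_right Finset.disjoint_sdiff
  have hF : A ∪ B ∪ C = F := Finset.union_sdiff_of_subset hABF
  have hτA : ∀ e ∈ A, τ e = 1 ∨ τ e = 2 := fun e he => hτ e (hAF he)
  have hτB : ∀ e ∈ B, τ e = 1 ∨ τ e = 2 := fun e he => hτ e (hBF he)
  have hfB : f ∈ B := Finset.mem_union_right _ (Finset.mem_singleton_self f)
  -- the kernel on the support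
  have hker : typedCount F z τ (K3 ends o a₁ a₂ a₃ b : Config E → Config E → Config E → R) =
      typedCount F z τ (fun x y w =>
        lK1 ends o a₁ b (restr A z x) (restr A z y) (restr A z w) *
            hK ends a₂ a₃ v f H1 (restr B z x) (restr B z y) (restr B z w) +
          lK2 ends o a₁ b (restr A z x) (restr A z y) (restr A z w) *
            hK ends a₂ a₃ v f H2 (restr B z x) (restr B z y) (restr B z w) +
          lK3 ends o a₁ b (restr A z x) (restr A z y) (restr A z w) *
            hK ends a₂ a₃ v f H3 (restr B z x) (restr B z y) (restr B z w) +
          lK4 ends o a₁ b (restr A z x) (restr A z y) (restr A z w) *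
            hK ends a₂ a₃ v f H4 (restr B z x) (restr B z y) (restr B z w)) := by
    refine typedCount_congr_on_support F z τ fun x y w hc hopen => ?_
    exact K3_eq_bridge ends o a₁ a₂ a₃ b v f τ (hτ f hf) hzf hf hends hsep hv ho hb h3
      (fun e he => (hc e he).1) (fun e he => (hc e he).2.1) (fun e he => (hc e he).2.2) (hopen f hf)
  rw [hker, typedCount_add4]
  -- factorise each product over the three parts
  have h1 := typedCount_mul_three A B C hAB hAC hBC z τ (lK1 ends o a₁ b) (hK ends a₂ a₃ v f H1 : Config E → Config E → Config E → R)
  have h2 := typedCount_mul_three A B C hAB hAC hBC z τ (lK2 ends o a₁ b) (hK ends a₂ a₃ v f H2 : Config E → Config E → Config E → R)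
  have h3' := typedCount_mul_three A B C hAB hAC hBC z τ (lK3 ends o a₁ b) (hK ends a₂ a₃ v f H3 : Config E → Config E → Config E → R)
  have h4 := typedCount_mul_three A B C hAB hAC hBC z τ (lK4 ends o a₁ b) (hK ends a₂ a₃ v f H4 : Config E → Config E → Config E → R)
  rw [hF] at h1 h2 h3' h4
  rw [h1, h2, h3', h4, count_lK1, count_lK2 ends o a₁ b A z τ hτA, count_lK3,
    count_lK4 ends o a₁ b A z τ hτA]
  have hsum := count_sum_eq_zero (R := R) ends a₂ a₃ v f B hfB z τ hτB
  set S := sSame (R := R) ends o a₁ b A z τ with hS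
  set X := sCross (R := R) ends o a₁ b A z τ with hX
  set T1 := typedCount B z τ (hK ends a₂ a₃ v f H1 : Config E → Config E → Config E → R) with hT1
  set T2 := typedCount B z τ (hK ends a₂ a₃ v f H2 : Config E → Config E → Config E → R) with hT2
  set T3 := typedCount B z τ (hK ends a₂ a₃ v f H3 : Config E → Config E → Config E → R) with hT3
  set T4 := typedCount B z τ (hK ends a₂ a₃ v f H4 : Config E → Config E → Config E → R) with hT4
  set I := typedCount C z τ (fun _ _ _ => (1 : R)) with hI
  linear_combination (X * I) * hsum

/-- **Row 2′TRI on the root-bridge class** (`P3-BRIDGE.md` §2): a typed edge `f = {a₁, v}` whose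
removal separates the roots, `o, b` on `a₁`'s side and `v, a₃` on the far side — for every
finite multigraph, every pinning `z` with the bridge closed off `F` and every type map with values
in `{1, 2}` on `F`. -/
theorem typedCount_nonneg_of_rootBridge (F : Finset E) (z : Config E) (τ : E → ℕ)
    (hτ : ∀ e ∈ F, τ e = 1 ∨ τ e = 2) (hzf : z f = false) (hf : f ∈ F)
    (hends : ends f = s(a₁, v)) (hsep : Sep ends a₁ a₂ (F.erase f) z)
    (hv : v ∈ cluster ends (zF (F.erase f) z) a₂) (ho : o ∈ cluster ends (zF (F.erase f) z) a₁)
    (hb : b ∈ cluster ends (zF (F.erase f) z) a₁) (h3 : a₃ ∈ cluster ends (zF (F.erase f) z) a₂) :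
    0 ≤ typedCount F z τ (K3 ends o a₁ a₂ a₃ b : Config E → Config E → Config E → R) := by
  rw [typedCount_eq_rootBridge ends o a₁ a₂ a₃ b v f F z τ hτ hzf hf hends hsep hv ho hb h3]
  have hAF : FL ends a₁ (F.erase f) z ⊆ F := fun e he =>
    Finset.mem_of_mem_erase (FL_subset ends a₁ (F.erase f) z he)
  have hBF : FL ends a₂ (F.erase f) z ∪ {f} ⊆ F := by
    intro e he
    rcases Finset.mem_union.1 he with he | he
    · exact Finset.mem_of_mem_erase (FL_subset ends a₂ (F.erase f) z he)
    · rw [Finset.mem_singleton.1 he]; exact hf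
  have hS := sSame_sub_sCross_nonneg (R := R) ends o a₁ b (FL ends a₁ (F.erase f) z) z τ
    (fun e he => hτ e (hAF he))
  have hT := count_H1_nonneg (R := R) ends a₂ a₃ v f (FL ends a₂ (F.erase f) z ∪ {f})
    (Finset.mem_union_right _ (Finset.mem_singleton_self f)) z τ (fun e he => hτ e (hBF he))
  have hI : (0 : R) ≤ typedCount (F \ (FL ends a₁ (F.erase f) z ∪ (FL ends a₂ (F.erase f) z ∪ {f})))
      z τ (fun _ _ _ => (1 : R)) :=
    typedCount_nonneg_of_nonneg _ _ _ fun _ _ _ => zero_le_one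
  exact mul_nonneg (mul_nonneg hS hT) hI

/-- The root-bridge class with an arbitrary pinning: the bridge bit of `z` is irrelevant
(`typedCount` only sees `z` off `F`), so the theorem holds for every `z`. -/
theorem typedCount_nonneg_of_rootBridge' (F : Finset E) (z : Config E) (τ : E → ℕ)
    (hτ : ∀ e ∈ F, τ e = 1 ∨ τ e = 2) (hf : f ∈ F) (hends : ends f = s(a₁, v))
    (hsep : Sep ends a₁ a₂ (F.erase f) (Function.update z f false))
    (hv : v ∈ cluster ends (zF (F.erase f) (Function.update z f false)) a₂)
    (ho : o ∈ cluster ends (zF (F.erase f) (Function.update z f false)) a₁)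
    (hb : b ∈ cluster ends (zF (F.erase f) (Function.update z f false)) a₁)
    (h3 : a₃ ∈ cluster ends (zF (F.erase f) (Function.update z f false)) a₂) :
    0 ≤ typedCount F z τ (K3 ends o a₁ a₂ a₃ b : Config E → Config E → Config E → R) := by
  rw [typedCount_congr_bg F τ (z' := Function.update z f false) (fun e he => by
    have hne : e ≠ f := fun h => he (by rw [h]; exact hf)
    rw [Function.update_of_ne hne])]
  exact typedCount_nonneg_of_rootBridge ends o a₁ a₂ a₃ b v f F _ τ hτ (by simp) hf hends hsep hv
    ho hb h3

/-- The typed graph `(V, F)` as a configuration: exactly the typed edges open. -/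
def typedConf (F : Finset E) : Config E := fun e => decide (e ∈ F)

omit [Fintype E] [LinearOrder R] [IsStrictOrderedRing R] in
/-- `z ∪ F` with `z ≡ false` is the typed graph. -/
lemma zF_false' (F : Finset E) : zF F (fun _ => false) = typedConf F := by
  funext e; simp [zF, typedConf]

/-- **The root-bridge same-side class** of the typed graph `(V, F)`: a typed edge `f = {a₁, v}`
whose removal separates the roots, with `o, b` on `a₁`'s side and `v, a₃` on `a₂`'s side. -/
def HasRootBridgeSameSide (F : Finset E) : Prop :=
  ∃ f ∈ F, ∃ v : V, ends f = s(a₁, v) ∧ ¬ Conn ends (typedConf (F.erase f)) a₂ a₁ ∧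
    v ∈ cluster ends (typedConf (F.erase f)) a₂ ∧ o ∈ cluster ends (typedConf (F.erase f)) a₁ ∧
    b ∈ cluster ends (typedConf (F.erase f)) a₁ ∧ a₃ ∈ cluster ends (typedConf (F.erase f)) a₂

/-- **Row 2′TRI on the root-bridge same-side class at `z ≡ false`** — the shape of sub-claim S1's
residual predicates. -/
theorem typedCount_nonneg_of_hasRootBridgeSameSide (F : Finset E) (τ : E → ℕ)
    (hτ : ∀ e ∈ F, τ e = 1 ∨ τ e = 2) (h : HasRootBridgeSameSide ends o a₁ a₂ a₃ b F) :
    0 ≤ typedCount F (fun _ => false) τ (K3 ends o a₁ a₂ a₃ b : Config E → Config E → Config E → R) := by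
  obtain ⟨f, hf, v, hends, hsep, hv, ho, hb, h3⟩ := h
  rw [← zF_false'] at hsep hv ho hb h3
  exact typedCount_nonneg_of_rootBridge ends o a₁ a₂ a₃ b v f F _ τ hτ rfl hf hends hsep hv ho hb h3

end Count

end RootBridge

end CovForm

end Summit.Ventures.PercRepro2

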